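import Summits.CriticalPhenomena.SAWScalingLimit.Theorems.SubseqIdentification.Negative.CoincidentEndpointLaw

/-!
# Load-bearing hypotheses of crux `SubseqIdentification` (stmt-CriticalPhenomena-0783)

Negative lemmas (refuter, cdisprove cycle 1) for the shared crux
`Summit.CriticalPhenomena.SAWScalingLimit.Theses.SAWRenewalTightness.SubseqIdentification`
("every subsequential weak limit of the critical `δℤ²` SAW laws along `s n → 0⁺` is the chordal
SLE_{8/3} law"): each of the following weakenings is FALSE, by explicit unit-disc witnesses in which
the SAW law degenerates to the Dirac mass at the trivial walk —
* `IsEndpointApprox` dropped, or weakened to its `reachable` field (so `reachable` is NOT load-bearing;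
  the two endpoint limits are);
* `tendsto_snd` alone dropped; `tendsto_fst` alone dropped (EACH endpoint limit is load-bearing);
* the mesh filter `𝓝[>] 0` weakened to `𝓝 0`; or to mere positivity of `s n` (no `s → 0`).
Toolkit: `Negative/CoincidentEndpointLaw.lean`.
-/

noncomputable section

open Literature.Probability.RandomPlanarGeometry Literature.Probability.RandomPlanarGeometry.SAW
  Literature.Probability.LatticeModels Literature.Probability.Percolation MeasureTheory Filter
  Topology Set
open scoped NNReal ENNReal BoundedContinuousFunction

namespace Summit.CriticalPhenomena.SAWScalingLimit.Theorems.SubseqIdentification.Negative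


/-! ### The endpoint hypothesis -/

/-- **`reachable` alone is not enough; the endpoint LIMITS are load-bearing.** Witness: the unit disc
`(𝔻; 1, -1)`, coincident endpoints `a δ = b δ = 0` (trivially joined), `s n = 1/(n+1)`: every law is the
Dirac mass at the trivial walk, whose class is `CurveClass.mk (Curve.const (0 : ℂ))` at every mesh, so the laws converge to
`μ = dirac (CurveClass.mk (Curve.const (0 : ℂ)))`, which starts at `0 ≠ 1 = a`, hence is no SLE law. Any proof of the crux
must therefore use `IsEndpointApprox.tendsto_fst` / `tendsto_snd`. [folklore] -/
theorem subseqIdentification_false_without_endpointLimits :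
    ¬ (∀ (D : DobrushinDomain) (a b : ℝ → Site 2),
    (∀ᶠ δ in 𝓝[>] (0 : ℝ), (discreteDomainGraph D.carrier δ).Reachable (a δ) (b δ)) →
    ∀ (s : ℕ → ℝ) (μ : Measure (CurveClass ℂ)),
    Tendsto s atTop (𝓝[>] (0 : ℝ)) → IsProbabilityMeasure μ →
    (∀ f : CurveClass ℂ →ᵇ ℝ, Tendsto (fun n => ∫ γ, f γ.curve
      ∂(law D.carrier (s n) (a (s n)) (b (s n)))) atTop (𝓝 (∫ x, f x ∂μ))) →
    IsSLELaw ((8 : ℝ≥0) / 3) D μ) := by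
  intro h
  refine not_isSLELaw_dirac_of_endpoint_ne (κ := (8 : ℝ≥0) / 3) (D := DobrushinDomain.unitDisc)
    (c := CurveClass.mk (Curve.const (0 : ℂ))) (Or.inl ?_) (h DobrushinDomain.unitDisc (fun _ => 0) (fun _ => 0)
      (Eventually.of_forall fun δ => SimpleGraph.Reachable.refl _) _ _ tendsto_inv_succ_nhdsGT
      inferInstance fun f => ?_)
  · rw [source_constClass, unitDisc_pt.1]
    norm_num
  · have hn : ∀ n : ℕ, ∫ γ, f γ.curve ∂(law DobrushinDomain.unitDisc.carrier (1 / ((n : ℝ) + 1))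
        ((fun _ : ℝ => (0 : Site 2)) (1 / ((n : ℝ) + 1)))
        ((fun _ : ℝ => (0 : Site 2)) (1 / ((n : ℝ) + 1)))) = ∫ x, f x ∂(Measure.dirac (CurveClass.mk (Curve.const (0 : ℂ)))) := by
      intro n
      rw [integral_law_zero, integral_dirac]
    simp_rw [hn]
    exact tendsto_const_nhds

/-- **`IsEndpointApprox` is load-bearing** (immediate from the previous theorem: dropping the whole
hypothesis is weaker than keeping `reachable`). [folklore] -/
theorem subseqIdentification_false_without_endpointApprox :
    ¬ (∀ (D : DobrushinDomain) (a b : ℝ → Site 2) (s : ℕ → ℝ) (μ : Measure (CurveClass ℂ)),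
    Tendsto s atTop (𝓝[>] (0 : ℝ)) → IsProbabilityMeasure μ →
    (∀ f : CurveClass ℂ →ᵇ ℝ, Tendsto (fun n => ∫ γ, f γ.curve
      ∂(law D.carrier (s n) (a (s n)) (b (s n)))) atTop (𝓝 (∫ x, f x ∂μ))) →
    IsSLELaw ((8 : ℝ≥0) / 3) D μ) := fun h =>
  subseqIdentification_false_without_endpointLimits fun D a b _ => h D a b

/-- Test integrals along coincident moving endpoints `a = b = e`: evaluation of `f` at the constant
class at `δ·e δ`, which converges whenever `δ·e δ` does. [folklore] -/
theorem tendsto_integral_coincident {Ω : Set ℂ} (e : ℝ → Site 2) {s : ℕ → ℝ} {z : ℂ}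
    (he : Tendsto (fun n => meshPoint (s n) (e (s n))) atTop (𝓝 z)) (f : CurveClass ℂ →ᵇ ℝ) :
    Tendsto (fun n => ∫ γ, f γ.curve ∂(law Ω (s n) (e (s n)) (e (s n)))) atTop
      (𝓝 (∫ x, f x ∂(Measure.dirac (CurveClass.mk (Curve.const z))))) := by
  have hn : (fun n => ∫ γ, f γ.curve ∂(law Ω (s n) (e (s n)) (e (s n)))) =
      fun n => f (CurveClass.mk (Curve.const (meshPoint (s n) (e (s n))))) :=
    funext fun n => integral_law_self Ω (s n) (e (s n)) f
  rw [hn, integral_dirac]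
  exact ((f.continuous.comp continuous_constClass).tendsto z).comp he

/-- **`tendsto_snd` is load-bearing on its own.** Witness: `(𝔻; 1, -1)`, `a = b = stdA` (coincident,
joined, `δ·stdA δ → 1 = a`), `s n = 1/(n+1)`: the laws are Dirac masses at constant classes at
`δ·stdA δ → 1`, converging to `μ = dirac (CurveClass.mk (Curve.const (1 : ℂ)))`, whose END point is `1 ≠ -1 = b`. [folklore] -/
theorem subseqIdentification_false_without_sndLimit : ¬ (∀ (D : DobrushinDomain) (a b : ℝ → Site 2),
    (∀ᶠ δ in 𝓝[>] (0 : ℝ), (discreteDomainGraph D.carrier δ).Reachable (a δ) (b δ)) →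
    Tendsto (fun δ => meshPoint δ (a δ)) (𝓝[>] (0 : ℝ)) (𝓝 (D.pt 0)) →
    ∀ (s : ℕ → ℝ) (μ : Measure (CurveClass ℂ)),
    Tendsto s atTop (𝓝[>] (0 : ℝ)) → IsProbabilityMeasure μ →
    (∀ f : CurveClass ℂ →ᵇ ℝ, Tendsto (fun n => ∫ γ, f γ.curve
      ∂(law D.carrier (s n) (a (s n)) (b (s n)))) atTop (𝓝 (∫ x, f x ∂μ))) →
    IsSLELaw ((8 : ℝ≥0) / 3) D μ) := by
  intro h
  have hlim : Tendsto (fun n : ℕ => meshPoint (1 / ((n : ℝ) + 1)) ![⌈(1 / ((n : ℝ) + 1))⁻¹⌉ - 1, 0]) atTop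
      (𝓝 1) := tendsto_meshPoint_stdA.comp tendsto_inv_succ_nhdsGT
  refine not_isSLELaw_dirac_of_endpoint_ne (κ := (8 : ℝ≥0) / 3) (D := DobrushinDomain.unitDisc)
    (c := CurveClass.mk (Curve.const (1 : ℂ))) (Or.inr ?_) (h DobrushinDomain.unitDisc (fun δ => ![⌈δ⁻¹⌉ - 1, 0]) (fun δ => ![⌈δ⁻¹⌉ - 1, 0])
      (Eventually.of_forall fun δ => SimpleGraph.Reachable.refl _)
      (by rw [unitDisc_pt.1]; exact tendsto_meshPoint_stdA) _ _ tendsto_inv_succ_nhdsGT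
      inferInstance fun f => tendsto_integral_coincident (fun δ => ![⌈δ⁻¹⌉ - 1, 0]) hlim f)
  rw [target_constClass, unitDisc_pt.2]
  norm_num

/-- **`tendsto_fst` is load-bearing on its own.** Mirror witness `a = b = stdB → -1 = b`: the limit
`dirac (CurveClass.mk (Curve.const (-1)))` STARTS at `-1 ≠ 1 = a`. [folklore] -/
theorem subseqIdentification_false_without_fstLimit : ¬ (∀ (D : DobrushinDomain) (a b : ℝ → Site 2),
    (∀ᶠ δ in 𝓝[>] (0 : ℝ), (discreteDomainGraph D.carrier δ).Reachable (a δ) (b δ)) →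
    Tendsto (fun δ => meshPoint δ (b δ)) (𝓝[>] (0 : ℝ)) (𝓝 (D.pt 1)) →
    ∀ (s : ℕ → ℝ) (μ : Measure (CurveClass ℂ)),
    Tendsto s atTop (𝓝[>] (0 : ℝ)) → IsProbabilityMeasure μ →
    (∀ f : CurveClass ℂ →ᵇ ℝ, Tendsto (fun n => ∫ γ, f γ.curve
      ∂(law D.carrier (s n) (a (s n)) (b (s n)))) atTop (𝓝 (∫ x, f x ∂μ))) →
    IsSLELaw ((8 : ℝ≥0) / 3) D μ) := by
  intro h
  have hlim : Tendsto (fun n : ℕ => meshPoint (1 / ((n : ℝ) + 1)) ![-(⌈(1 / ((n : ℝ) + 1))⁻¹⌉ - 1), 0]) atTop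
      (𝓝 (-1)) := tendsto_meshPoint_stdB.comp tendsto_inv_succ_nhdsGT
  refine not_isSLELaw_dirac_of_endpoint_ne (κ := (8 : ℝ≥0) / 3) (D := DobrushinDomain.unitDisc)
    (c := CurveClass.mk (Curve.const (-1))) (Or.inl ?_) (h DobrushinDomain.unitDisc (fun δ => ![-(⌈δ⁻¹⌉ - 1), 0]) (fun δ => ![-(⌈δ⁻¹⌉ - 1), 0])
      (Eventually.of_forall fun δ => SimpleGraph.Reachable.refl _)
      (by rw [unitDisc_pt.2]; exact tendsto_meshPoint_stdB) _ _ tendsto_inv_succ_nhdsGT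
      inferInstance fun f => tendsto_integral_coincident (fun δ => ![-(⌈δ⁻¹⌉ - 1), 0]) hlim f)
  rw [source_constClass, unitDisc_pt.1]
  norm_num

/-! ### The mesh hypothesis `s → 0⁺` -/

/-- **One-sidedness of the mesh filter is load-bearing** (formally): `IsEndpointApprox` constrains
`(a, b)` only on `𝓝[>] 0`, so along NEGATIVE meshes `s n = -1/(n+1) → 0` the endpoints are free;
patch the honest approximation `(stdA, stdB)` to `a δ = b δ = 0` for `δ ≤ 0`: the laws are
`dirac (trivial walk)`, the limit is `dirac (CurveClass.mk (Curve.const (0 : ℂ)))`, not an SLE law. (Geometrically a negative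
mesh is the same lattice `|δ|ℤ²` relabelled by `x ↦ -x`, so nothing is lost by the one-sided filter;
the point is only that the endpoint hypothesis and the mesh filter must look at the same side.)
[folklore] -/
theorem subseqIdentification_false_without_oneSided : ¬ (∀ (D : DobrushinDomain) (a b : ℝ → Site 2), IsEndpointApprox D a b →
    ∀ (s : ℕ → ℝ) (μ : Measure (CurveClass ℂ)),
    Tendsto s atTop (𝓝 (0 : ℝ)) → IsProbabilityMeasure μ →
    (∀ f : CurveClass ℂ →ᵇ ℝ, Tendsto (fun n => ∫ γ, f γ.curve
      ∂(law D.carrier (s n) (a (s n)) (b (s n)))) atTop (𝓝 (∫ x, f x ∂μ))) →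
    IsSLELaw ((8 : ℝ≥0) / 3) D μ) := by
  intro h
  set a' : ℝ → Site 2 := fun δ => if 0 < δ then ![⌈δ⁻¹⌉ - 1, 0] else 0 with ha'
  set b' : ℝ → Site 2 := fun δ => if 0 < δ then ![-(⌈δ⁻¹⌉ - 1), 0] else 0 with hb'
  have hab : IsEndpointApprox DobrushinDomain.unitDisc a' b' :=
    isEndpointApprox_congr isEndpointApprox_std
      (mem_of_superset self_mem_nhdsWithin fun δ (hδ : 0 < δ) => by simp [ha', hδ])
      (mem_of_superset self_mem_nhdsWithin fun δ (hδ : 0 < δ) => by simp [hb', hδ])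
  have hs : Tendsto (fun n : ℕ => -(1 / ((n : ℝ) + 1))) atTop (𝓝 (0 : ℝ)) := by
    have := (tendsto_one_div_add_atTop_nhds_zero_nat (𝕜 := ℝ)).neg
    rwa [neg_zero] at this
  have hneg : ∀ n : ℕ, ¬ (0 : ℝ) < -(1 / ((n : ℝ) + 1)) := fun n => by
    rw [not_lt, neg_nonpos]; positivity
  have ha0 : ∀ n : ℕ, a' (-(1 / ((n : ℝ) + 1))) = 0 := fun n => if_neg (hneg n)
  have hb0 : ∀ n : ℕ, b' (-(1 / ((n : ℝ) + 1))) = 0 := fun n => if_neg (hneg n)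
  refine not_isSLELaw_dirac_of_endpoint_ne (κ := (8 : ℝ≥0) / 3) (D := DobrushinDomain.unitDisc)
    (c := CurveClass.mk (Curve.const (0 : ℂ))) (Or.inl ?_) (h DobrushinDomain.unitDisc a' b' hab _ _ hs inferInstance fun f => ?_)
  · rw [source_constClass, unitDisc_pt.1]
    norm_num
  · have hn : (fun n : ℕ => ∫ γ, f γ.curve ∂(law DobrushinDomain.unitDisc.carrier
        (-(1 / ((n : ℝ) + 1))) (a' (-(1 / ((n : ℝ) + 1)))) (b' (-(1 / ((n : ℝ) + 1)))))) =
        fun _ => f (CurveClass.mk (Curve.const (0 : ℂ))) :=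
      funext fun n => by rw [integral_law_of_eq_zero (ha0 n) (hb0 n)]
    rw [hn, integral_dirac]
    exact tendsto_const_nhds

/-- **Convergence of the mesh to `0` is load-bearing; positivity is not enough.** Witness: the fixed
mesh `s ≡ 2` with the honest approximation patched at `δ = 2` only (`a 2 = b 2 = 0`; invisible to
`IsEndpointApprox`, which looks at `𝓝[>] 0`): the laws are constantly `dirac (trivial walk at 0)`,
limit `dirac (CurveClass.mk (Curve.const (0 : ℂ)))`, not an SLE law. The same patch at any fixed `δ₀ > 0` refutes
"identification at a fixed positive mesh". [folklore] -/
theorem subseqIdentification_false_without_meshToZero : ¬ (∀ (D : DobrushinDomain) (a b : ℝ → Site 2), IsEndpointApprox D a b →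
    ∀ (s : ℕ → ℝ) (μ : Measure (CurveClass ℂ)),
    (∀ n, 0 < s n) → IsProbabilityMeasure μ →
    (∀ f : CurveClass ℂ →ᵇ ℝ, Tendsto (fun n => ∫ γ, f γ.curve
      ∂(law D.carrier (s n) (a (s n)) (b (s n)))) atTop (𝓝 (∫ x, f x ∂μ))) →
    IsSLELaw ((8 : ℝ≥0) / 3) D μ) := by
  intro h
  set a' : ℝ → Site 2 := fun δ => if δ = 2 then 0 else ![⌈δ⁻¹⌉ - 1, 0] with ha'
  set b' : ℝ → Site 2 := fun δ => if δ = 2 then 0 else ![-(⌈δ⁻¹⌉ - 1), 0] with hb'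
  have hne : ∀ᶠ δ in 𝓝[>] (0 : ℝ), δ ≠ 2 := by
    filter_upwards [Ioo_mem_nhdsGT (by norm_num : (0 : ℝ) < 2)] with δ hδ
    exact hδ.2.ne
  have hab : IsEndpointApprox DobrushinDomain.unitDisc a' b' :=
    isEndpointApprox_congr isEndpointApprox_std
      (hne.mono fun δ hδ => by simp [ha', hδ]) (hne.mono fun δ hδ => by simp [hb', hδ])
  have ha0 : a' 2 = 0 := if_pos rfl
  have hb0 : b' 2 = 0 := if_pos rfl
  refine not_isSLELaw_dirac_of_endpoint_ne (κ := (8 : ℝ≥0) / 3) (D := DobrushinDomain.unitDisc)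
    (c := CurveClass.mk (Curve.const (0 : ℂ))) (Or.inl ?_) (h DobrushinDomain.unitDisc a' b' hab (fun _ => 2) _
      (fun _ => by norm_num) inferInstance fun f => ?_)
  · rw [source_constClass, unitDisc_pt.1]
    norm_num
  · have hn : (fun n : ℕ => ∫ γ, f γ.curve ∂(law DobrushinDomain.unitDisc.carrier
        ((fun _ : ℕ => (2 : ℝ)) n) (a' ((fun _ : ℕ => (2 : ℝ)) n)) (b' ((fun _ : ℕ => (2 : ℝ)) n)))) =
        fun _ => f (CurveClass.mk (Curve.const (0 : ℂ))) :=
      funext fun n => by rw [integral_law_of_eq_zero ha0 hb0]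
    rw [hn, integral_dirac]
    exact tendsto_const_nhds

end Summit.CriticalPhenomena.SAWScalingLimit.Theorems.SubseqIdentification.Negative
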